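import Summits.AtomisticToContinuum.FouriersLaw.Theorems.EmbeddedDrudeMourreAbelThermodynamicLimitAnchoredCorrelationTailsSingleFlip
import Summits.AtomisticToContinuum.FouriersLaw.Theorems.EmbeddedDrudeMourreAbelThermodynamicLimitAnchoredCorrelationTailsPairing
import Summits.AtomisticToContinuum.FouriersLaw.Theorems.LatticeLandauDampingAbelThermodynamicLimitFixedTimeMatchingSharedLeaves

/-!
# Leaf (C) `stub_anchoredCorrelationTails` of S4, line `loomis-compact-horizon-witness`: the light cone of the OPEN
chain at fixed time, uniformly in `N` (crux `EmbeddedDrudeMourre.AbelThermodynamicLimit`, item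
stmt-AtomisticToContinuum-12596; `--supports` file proving the registered leaf VERBATIM and the registered sub-goal
`stub_singleFlipLightConeSummable`; closes nothing). Parts 1–6: `…AnchoredCorrelationTailsLocalLipschitz|Propagation|
SiteTails|BadEvent|SingleFlip|Pairing`.

For `P = pinnedChain ω₂ lam β γ` (all `> 0`), `T > 0`, the equilibrium pair correlations of bond currents of the open
`N`-chain, `K_N(i,k,t) = ∫ j_i · κ_t j_k dμ_{N,T}` (`μ_{N,T} = gibbsMeasure N T`, `κ_t = transitionKernel N T T t`),
have `N`-UNIFORM TAILS on every compact horizon: for `τ > 0`, `ε > 0` there is `R` with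
`Σ_{|k - i| > R} |K_N(i, k, t)| ≤ ε` for ALL `N`, every `R`-deep bond `i` and `t ∈ [0, τ]`
(`uniformAnchoredCorrelationTails`, the anchor-uniform form (C′) of the twin line; the registered central-anchor leaf
(C) follows by the landed `SeriesLawAtEveryLaplaceFrequency.stub_anchoredCorrelationTailsOfUniform`).

* §4 `single_flip_lightCone_summable` — the single-flip estimate of part 5 with box scale `R² = D/(48eAτ)`: cone term
  `O(D⁴4^{-D})`, failure term `O(D^{-7/2})`, so `‖j_k(Φ_s(Θ_{i₀}·)) − j_k(Φ_s ·)‖_{L²(μ_T ⊗ W)} ≤ a(D)` with `a`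
  SUMMABLE (`O(D²2^{-D} + D^{-7/4})`) and independent of `N`, for `s ≤ τ`, `D ≥ D₀(τ)`.
* §6 — by the pairing bound of part 6, `|K_N(c,k,t)| ≤ ψ(|k - c|)`, `ψ(n) = √(M/2)(a(n) + a(n-1))` summable
  (`⟨j_c²⟩_{N,T} ≤ M`, `pinnedChain_integral_sq_bondCurrent_gibbsMeasure_le`); the far blocks of a summable series are
  uniformly small (`summable_iff_vanishing_norm`), whence (C′) with no `N₀` needed, and (C).

All statements proved; `[folklore]` (finite-volume noisy analogue of Buttà–Marchioro, J. Stat. Phys. 164 (2016) 680,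
§4, via the synchronous coupling of crux `JunctionLocality.NonBallistic`). No definitions.
-/


noncomputable section

namespace Summit.AtomisticToContinuum.FouriersLaw.Theorems.AbelThermodynamicLimit.LoomisCompactHorizonWitness

open MeasureTheory ProbabilityTheory Set Filter Topology
open scoped NNReal ENNReal
open Literature.MathematicalPhysics.KineticTheory Literature.MathematicalPhysics.KineticTheory.HeatConduction
open Literature.Probability.Process OscillatorChain Summit.AtomisticToContinuum.FouriersLaw.Theorems.NonBallistic

/-! ### §4 The summable single-flip light cone -/

section Summable

/-- `√(√(D⁷)) = D^{7/4}` for `D ≥ 0`. [folklore] -/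
theorem sqrt_sqrt_pow_seven {x : ℝ} (hx : 0 ≤ x) : Real.sqrt (Real.sqrt (x ^ 7)) = x ^ (7 / 4 : ℝ) := by
  rw [Real.sqrt_eq_rpow, Real.sqrt_eq_rpow, ← Real.rpow_natCast x 7, ← Real.rpow_mul hx, ← Real.rpow_mul hx]
  norm_num

variable {ω₂ lam β γ : ℝ} (hω : 0 < ω₂) (hl : 0 < lam) (hβ : 0 < β) (hγ : 0 < γ) {T : ℝ} (hT : 0 < T)

include hω hl hβ hγ hT in
/-- **The single-flip light cone of the open chain, summable and `N`-uniform form.** For every horizon `τ > 0` there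
are a threshold `D₀` and a SUMMABLE sequence `a ≥ 0` such that for every `N`, every flipped site `i₀`, every genuine
bond `(k, k+1)` whose sites are at distance `D` or `D+1 ≥ D ≥ D₀` from `i₀`, and every `s ≤ τ`,
`‖j_k(Φ_s(Θ_{i₀}·)) − j_k(Φ_s ·)‖_{L²(μ_T ⊗ W)} ≤ a(D)`: the single-flip estimate with the box scale `R² = D/(48eAτ)`
(cone term `O(D⁴4^{-D})`, failure term `O(D^{-7/2})`, so `a(D) = O(D²2^{-D} + D^{-7/4})`). [folklore] -/
theorem single_flip_lightCone_summable (τ : ℝ) (hτ : 0 < τ) :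
    ∃ (D₀ : ℕ) (a : ℕ → ℝ), (∀ n, 0 ≤ a n) ∧ Summable a ∧
      ∀ (N : ℕ) (i₀ k : Fin N) (hk : k.val + 1 < N) (D : ℕ), D₀ ≤ D →
        D ≤ ((k : ℤ) - (i₀ : ℤ)).natAbs → ((k : ℤ) - (i₀ : ℤ)).natAbs ≤ D + 1 →
        D ≤ ((k : ℤ) + 1 - (i₀ : ℤ)).natAbs → ((k : ℤ) + 1 - (i₀ : ℤ)).natAbs ≤ D + 1 →
        ∀ s : ℝ≥0, (s : ℝ) ≤ τ →
          ∫⁻ x, ∫⁻ ω, ENNReal.ofReal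
              (((pinnedChain ω₂ lam β γ).bondCurrent N k
                  ((pinnedChain ω₂ lam β γ).solMap N T T s (momentumFlip i₀ x) (pairPath ω)) -
                (pinnedChain ω₂ lam β γ).bondCurrent N k
                  ((pinnedChain ω₂ lam β γ).solMap N T T s x (pairPath ω))) ^ 2)
              ∂wienerPair ∂((pinnedChain ω₂ lam β γ).gibbsMeasure N T) ≤ ENNReal.ofReal (a D ^ 2) := by
  set P := pinnedChain ω₂ lam β γ with hP
  obtain ⟨C₄, hC₄0, hC₄⟩ := pinnedChain_contactCurrentFourthMoment ω₂ lam β γ hω hl.le hβ.le T hT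
  -- `e = exp 1`, kept opaque (closed real terms make `whnf` expensive inside `linarith`)
  obtain ⟨e, he0, hedef⟩ : ∃ e : ℝ, 0 < e ∧ Real.exp 1 = e := ⟨_, Real.exp_pos 1, rfl⟩
  obtain ⟨A, hA⟩ : ∃ A : ℝ, A = 3 + ω₂ + 3 * lam + 24 * β + 2 * γ := ⟨_, rfl⟩
  have hA0 : 0 < A := by rw [hA]; positivity
  obtain ⟨c₀, hc₀⟩ : ∃ c₀ : ℝ, c₀ = 48 * e * A * τ := ⟨_, rfl⟩
  have hc₀0 : 0 < c₀ := by rw [hc₀]; positivity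
  obtain ⟨κr, hκr⟩ : ∃ κr : ℝ, κr = (((∫⁻ a, ENNReal.ofReal (a ^ 16) * ENNReal.ofReal (Real.exp (-P.U a / T))) /
      ∫⁻ a, ENNReal.ofReal (Real.exp (-P.U a / T))).toReal) := ⟨_, rfl⟩
  have hκr0 : 0 ≤ κr := by rw [hκr]; exact ENNReal.toReal_nonneg
  -- the box scale and the two terms of the single-flip estimate, as functions of the distance
  obtain ⟨Rf, hRf⟩ : ∃ Rf : ℕ → ℝ, ∀ D, Rf D = Real.sqrt (D / c₀) := ⟨_, fun _ => rfl⟩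
  obtain ⟨term1, hterm1⟩ : ∃ term1 : ℕ → ℝ, ∀ D,
      term1 D = (448 * (1 + β) * Rf D ^ 3 * (1 / 2) ^ D) ^ 2 * (195 * T ^ 2 + 32) := ⟨_, fun _ => rfl⟩
  obtain ⟨term2, hterm2⟩ : ∃ term2 : ℕ → ℝ, ∀ D, term2 D = 4 * Real.sqrt (C₄ *
      (7 * D * (κr * 4 ^ 8 / Rf D ^ 16) + 2 * (7 * D * (2027025 * T ^ 8 * 4 ^ 8 * τ ^ 16 / Rf D ^ 16)))) :=
    ⟨_, fun _ => rfl⟩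
  have hterm1_0 : ∀ D, 0 ≤ term1 D := fun D => by rw [hterm1]; positivity
  have hterm2_0 : ∀ D, 0 ≤ term2 D := fun D => by rw [hterm2]; positivity
  obtain ⟨D₀, hD₀1, hD₀c⟩ : ∃ D₀ : ℕ, 1 ≤ D₀ ∧ c₀ ≤ D₀ :=
    ⟨⌈c₀⌉₊ + 1, by omega, (Nat.le_ceil c₀).trans (by exact_mod_cast Nat.le_succ _)⟩
  obtain ⟨a, ha⟩ : ∃ a : ℕ → ℝ, ∀ D, a D = if D₀ ≤ D then Real.sqrt (term1 D) + Real.sqrt (term2 D) else 0 :=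
    ⟨_, fun _ => rfl⟩
  have ha0 : ∀ n, 0 ≤ a n := fun n => by rw [ha]; split_ifs <;> positivity
  -- the summable majorants
  obtain ⟨K₄, hK₄⟩ : ∃ K₄ : ℝ, K₄ = 448 * (1 + β) * Real.sqrt (195 * T ^ 2 + 32) / c₀ ^ 2 := ⟨_, rfl⟩
  obtain ⟨K₁, hK₁⟩ : ∃ K₁ : ℝ, K₁ = 7 * 4 ^ 8 * c₀ ^ 8 * (κr + 2 * (2027025 * T ^ 8 * τ ^ 16)) := ⟨_, rfl⟩
  obtain ⟨K₃, hK₃⟩ : ∃ K₃ : ℝ, K₃ = 2 * Real.sqrt (Real.sqrt (C₄ * K₁)) := ⟨_, rfl⟩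
  have hK₄0 : 0 ≤ K₄ := by rw [hK₄]; positivity
  have hK₁0 : 0 ≤ K₁ := by rw [hK₁]; positivity
  have hK₃0 : 0 ≤ K₃ := by rw [hK₃]; positivity
  have hDfacts : ∀ D : ℕ, D₀ ≤ D → (1 : ℝ) ≤ D ∧ c₀ ≤ D ∧ 1 ≤ Rf D ^ 2 ∧ Rf D ^ 2 = D / c₀ ∧ 1 ≤ Rf D := by
    intro D hD
    have hD1 : (1 : ℝ) ≤ D := by exact_mod_cast hD₀1.trans hD
    have hcD : c₀ ≤ D := hD₀c.trans (by exact_mod_cast hD)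
    have hR2 : Rf D ^ 2 = D / c₀ := by rw [hRf]; exact Real.sq_sqrt (by positivity)
    have hR21 : 1 ≤ Rf D ^ 2 := by rw [hR2, le_div_iff₀ hc₀0, one_mul]; exact hcD
    have hR0 : 0 ≤ Rf D := by rw [hRf]; exact Real.sqrt_nonneg _
    have hR1 : 1 ≤ Rf D := by
      have h := (one_le_sq_iff_one_le_abs _).1 hR21
      rwa [abs_of_nonneg hR0] at h
    exact ⟨hD1, hcD, hR21, hR2, hR1⟩
  have hmaj1 : ∀ D : ℕ, D₀ ≤ D → Real.sqrt (term1 D) ≤ K₄ * ((D : ℝ) ^ 2 * (1 / 2 : ℝ) ^ D) := by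
    intro D hD
    obtain ⟨hD1, hcD, hR21, hR2, hR1⟩ := hDfacts D hD
    have hR0 : 0 ≤ Rf D := zero_le_one.trans hR1
    have eq1 : Real.sqrt (term1 D) = 448 * (1 + β) * Rf D ^ 3 * (1 / 2) ^ D * Real.sqrt (195 * T ^ 2 + 32) := by
      rw [hterm1, Real.sqrt_mul (sq_nonneg _), Real.sqrt_sq (by positivity)]
    rw [eq1, hK₄]
    have hRR : Rf D ≤ Rf D ^ 2 := by
      calc Rf D = Rf D * 1 := (mul_one _).symm
        _ ≤ Rf D * Rf D := mul_le_mul_of_nonneg_left hR1 hR0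
        _ = Rf D ^ 2 := (sq _).symm
    have hR3 : Rf D ^ 3 ≤ (D / c₀) ^ 2 := by
      calc Rf D ^ 3 = Rf D ^ 2 * Rf D := by ring
        _ ≤ Rf D ^ 2 * Rf D ^ 2 := mul_le_mul_of_nonneg_left hRR (by positivity)
        _ = (D / c₀) ^ 2 := by rw [hR2]; ring
    have h0 : 0 ≤ 448 * (1 + β) * (1 / 2 : ℝ) ^ D * Real.sqrt (195 * T ^ 2 + 32) := by positivity
    have hc₀ne : c₀ ≠ 0 := hc₀0.ne'
    calc 448 * (1 + β) * Rf D ^ 3 * (1 / 2) ^ D * Real.sqrt (195 * T ^ 2 + 32)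
        = (448 * (1 + β) * (1 / 2 : ℝ) ^ D * Real.sqrt (195 * T ^ 2 + 32)) * Rf D ^ 3 := by ring
      _ ≤ (448 * (1 + β) * (1 / 2 : ℝ) ^ D * Real.sqrt (195 * T ^ 2 + 32)) * (D / c₀) ^ 2 :=
          mul_le_mul_of_nonneg_left hR3 h0
      _ = 448 * (1 + β) * Real.sqrt (195 * T ^ 2 + 32) / c₀ ^ 2 * ((D : ℝ) ^ 2 * (1 / 2) ^ D) := by
          field_simp
  have hmaj2 : ∀ D : ℕ, D₀ ≤ D → Real.sqrt (term2 D) ≤ K₃ * ((D : ℝ) ^ (7 / 4 : ℝ))⁻¹ := by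
    intro D hD
    obtain ⟨hD1, hcD, hR21, hR2, hR1⟩ := hDfacts D hD
    have hDpos : (0 : ℝ) < D := lt_of_lt_of_le one_pos hD1
    have hDne : (D : ℝ) ≠ 0 := hDpos.ne'
    have hc₀ne : c₀ ≠ 0 := hc₀0.ne'
    have hR16 : Rf D ^ 16 = (D / c₀) ^ 8 := by rw [show (16 : ℕ) = 2 * 8 by rfl, pow_mul, hR2]
    have hinner : 7 * D * (κr * 4 ^ 8 / Rf D ^ 16) + 2 * (7 * D * (2027025 * T ^ 8 * 4 ^ 8 * τ ^ 16 / Rf D ^ 16)) =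
        K₁ / (D : ℝ) ^ 7 := by
      rw [hR16, hK₁]
      field_simp
    have eq2 : Real.sqrt (term2 D) = K₃ * ((D : ℝ) ^ (7 / 4 : ℝ))⁻¹ := by
      rw [hterm2, hinner, hK₃, ← sqrt_sqrt_pow_seven hDpos.le]
      have h7 : 0 < (D : ℝ) ^ 7 := by positivity
      rw [show C₄ * (K₁ / (D : ℝ) ^ 7) = (C₄ * K₁) / (D : ℝ) ^ 7 by ring, Real.sqrt_div' _ h7.le,
        Real.sqrt_mul' _ (div_nonneg (Real.sqrt_nonneg _) (Real.sqrt_nonneg _)),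
        Real.sqrt_div' _ (Real.sqrt_nonneg _), show Real.sqrt 4 = 2 by
          rw [show (4 : ℝ) = 2 ^ 2 by norm_num, Real.sqrt_sq (by norm_num)], div_eq_mul_inv]
      ring
    rw [eq2]
  have hsum : Summable a := by
    have hg1 : Summable fun D : ℕ => K₄ * ((D : ℝ) ^ 2 * (1 / 2 : ℝ) ^ D) :=
      (summable_pow_mul_geometric_of_norm_lt_one 2 (by norm_num : ‖(1 / 2 : ℝ)‖ < 1)).mul_left K₄
    have hg2 : Summable fun D : ℕ => K₃ * ((D : ℝ) ^ (7 / 4 : ℝ))⁻¹ :=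
      (Real.summable_nat_rpow_inv.2 (by norm_num)).mul_left K₃
    refine (hg1.add hg2).of_nonneg_of_le ha0 fun D => ?_
    rw [ha]
    split_ifs with hD
    · exact add_le_add (hmaj1 D hD) (hmaj2 D hD)
    · positivity
  refine ⟨D₀, a, ha0, hsum, ?_⟩
  intro N i₀ k hk D hD hDk hDk' hDk1 hDk1' s hs
  obtain ⟨hD1, hcD, hR21, hR2, hR1⟩ := hDfacts D hD
  have hDnat : 1 ≤ D := hD₀1.trans hD
  have hreg : 12 * Real.exp 1 * (2 * ((3 + ω₂ + 3 * lam + 24 * β + 2 * γ) * Rf D ^ 2)) * τ ≤ D := by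
    rw [hedef, ← hA, hR2]
    have hc₀ne : c₀ ≠ 0 := hc₀0.ne'
    have eq3 : 12 * e * (2 * (A * (D / c₀))) * τ = D / 2 := by
      rw [hc₀]; field_simp; ring
    rw [eq3]
    have hD0' : (0 : ℝ) ≤ D := zero_le_one.trans hD1
    exact (half_le_self hD0')
  have hmain := single_flip_estimate_cone hω hl hβ hγ hT i₀ k hk hDnat hDk hDk' hDk1 hDk1' hR1 hτ.le hC₄0 hreg
    (hC₄ N k) s hs
  refine hmain.trans ?_
  have e1 : (448 * (1 + β) * Rf D ^ 3 * (1 / 2) ^ D) ^ 2 * (195 * T ^ 2 + 32) = term1 D := (hterm1 D).symm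
  have e2 : 4 * Real.sqrt (C₄ * (7 * D * ((((∫⁻ a, ENNReal.ofReal (a ^ 16) *
        ENNReal.ofReal (Real.exp (-P.U a / T))) / ∫⁻ a, ENNReal.ofReal (Real.exp (-P.U a / T))).toReal) *
          4 ^ 8 / Rf D ^ 16) + 2 * (7 * D * (2027025 * T ^ 8 * 4 ^ 8 * τ ^ 16 / Rf D ^ 16)))) = term2 D := by
    rw [hterm2, hκr]
  rw [e1, e2, ← ENNReal.ofReal_add (hterm1_0 D) (hterm2_0 D)]
  refine ENNReal.ofReal_le_ofReal ?_
  have haD : a D = Real.sqrt (term1 D) + Real.sqrt (term2 D) := by rw [ha, if_pos hD]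
  rw [haD, add_sq, Real.sq_sqrt (hterm1_0 D), Real.sq_sqrt (hterm2_0 D)]
  have h2 : 0 ≤ 2 * Real.sqrt (term1 D) * Real.sqrt (term2 D) := by positivity
  have h3 : term1 D ≤ term1 D + 2 * Real.sqrt (term1 D) * Real.sqrt (term2 D) := le_add_of_nonneg_right h2
  exact add_le_add h3 le_rfl

/-- **Registered sub-goal `stub_singleFlipLightConeSummable`** (leaf (C) of S4, line `loomis-compact-horizon-witness`):
the single-flip light cone of the open chain, summable and `N`-uniform (`single_flip_lightCone_summable`, closed form).
[folklore] -/
theorem stub_singleFlipLightConeSummable :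
    ∀ ω₂ lam β γ : ℝ, 0 < ω₂ → 0 < lam → 0 < β → 0 < γ → ∀ T : ℝ, 0 < T → ∀ τ : ℝ, 0 < τ →
      ∃ (D₀ : ℕ) (a : ℕ → ℝ), (∀ n, 0 ≤ a n) ∧ Summable a ∧
        ∀ (N : ℕ) (i₀ k : Fin N) (hk : k.val + 1 < N) (D : ℕ), D₀ ≤ D →
          D ≤ ((k : ℤ) - (i₀ : ℤ)).natAbs → ((k : ℤ) - (i₀ : ℤ)).natAbs ≤ D + 1 →
          D ≤ ((k : ℤ) + 1 - (i₀ : ℤ)).natAbs → ((k : ℤ) + 1 - (i₀ : ℤ)).natAbs ≤ D + 1 →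
          ∀ s : NNReal, (s : ℝ) ≤ τ →
            ∫⁻ x, ∫⁻ ω, ENNReal.ofReal
                (((Literature.MathematicalPhysics.KineticTheory.HeatConduction.pinnedChain ω₂ lam β γ).bondCurrent N k
                    ((Literature.MathematicalPhysics.KineticTheory.HeatConduction.pinnedChain ω₂ lam β γ).solMap N T T s
                      (Literature.MathematicalPhysics.KineticTheory.HeatConduction.momentumFlip i₀ x)
                      (Literature.Probability.Process.pairPath ω)) -
                  (Literature.MathematicalPhysics.KineticTheory.HeatConduction.pinnedChain ω₂ lam β γ).bondCurrent N k
                    ((Literature.MathematicalPhysics.KineticTheory.HeatConduction.pinnedChain ω₂ lam β γ).solMap N T T s x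
                      (Literature.Probability.Process.pairPath ω))) ^ 2)
                ∂Literature.Probability.Process.wienerPair
                ∂((Literature.MathematicalPhysics.KineticTheory.HeatConduction.pinnedChain ω₂ lam β γ).gibbsMeasure N T) ≤
              ENNReal.ofReal (a D ^ 2) :=
  fun _ _ _ _ hω hl hβ hγ _ hT τ hτ => single_flip_lightCone_summable hω hl hβ hγ hT τ hτ

end Summable
/-! ### §6 The anchored correlation tails -/

section Tails

/-- **Anchor-uniform `N`-uniform correlation tails of the open chain at fixed time** ((C′) of the twin line, which
contains the registered leaf (C)): for `τ > 0`, `ε > 0` there is `R` with `Σ_{|k - i| > R} |⟨j_i(0) j_k(t)⟩_{N,T}| ≤ ε` for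
EVERY `N`, every `R`-deep bond `i`, `t ∈ [0, τ]` (`|⟨j_i(0) j_k(t)⟩| ≤ ψ(|k - i|)`, `ψ` summable; `summable_iff_vanishing_norm`).
[folklore] -/
theorem uniformAnchoredCorrelationTails :
    ∀ ω₂ lam β γ : ℝ, 0 < ω₂ → 0 < lam → 0 < β → 0 < γ → ∀ T : ℝ, 0 < T →
      ∀ τ : ℝ, 0 < τ → ∀ ε : ℝ, 0 < ε → ∃ R N₀ : ℕ, ∀ N : ℕ, N₀ ≤ N → ∀ i : Fin N,
        R ≤ i.val → i.val + R < N → ∀ t ∈ Set.Icc (0 : ℝ) τ,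
          (∑ k : Fin N, if i.val ≤ k.val + R ∧ k.val ≤ i.val + R then (0 : ℝ) else
            |∫ z, (pinnedChain ω₂ lam β γ).bondCurrent N i z *
                (∫ y, (pinnedChain ω₂ lam β γ).bondCurrent N k y
                  ∂((pinnedChain ω₂ lam β γ).transitionKernel N T T t.toNNReal z))
              ∂((pinnedChain ω₂ lam β γ).gibbsMeasure N T)|) ≤ ε := by
  intro ω₂ lam β γ hω hl hβ hγ T hT τ hτ ε hε
  classical
  set P := pinnedChain ω₂ lam β γ with hP
  obtain ⟨M, hM⟩ := pinnedChain_integral_sq_bondCurrent_gibbsMeasure_le (γ := γ) hω hl hβ hT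
  obtain ⟨D₀, a, ha0, hsum, hfl⟩ := single_flip_lightCone_summable hω hl hβ hγ hT τ hτ
  -- the summable majorant of the pair correlations at distance `n`
  obtain ⟨ψ, hψ⟩ : ∃ ψ : ℕ → ℝ, ∀ n, ψ n = Real.sqrt (M / 2) * (a n + a (n - 1)) := ⟨_, fun _ => rfl⟩
  have hψ0 : ∀ n, 0 ≤ ψ n := fun n => by
    rw [hψ]; exact mul_nonneg (Real.sqrt_nonneg _) (add_nonneg (ha0 _) (ha0 _))
  have hψsum : Summable ψ := by
    have h1 : Summable fun n : ℕ => a (n - 1) := by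
      refine (summable_nat_add_iff 1).1 ?_
      simpa using hsum
    have h2 : Summable fun n : ℕ => Real.sqrt (M / 2) * (a n + a (n - 1)) := (hsum.add h1).mul_left _
    exact h2.congr fun n => (hψ n).symm
  -- the far blocks of `Σ ψ` are uniformly small
  obtain ⟨s₀, hs₀⟩ := (summable_iff_vanishing_norm.1 hψsum) (ε / 2) (half_pos hε)
  obtain ⟨R, hR⟩ : ∃ R : ℕ, R = s₀.sup id + D₀ + 1 := ⟨_, rfl⟩
  have hRs : ∀ m ∈ s₀, m < R := fun m hm => by
    have := Finset.le_sup (f := id) hm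
    simp only [id_eq] at this
    omega
  have hRD : D₀ + 1 ≤ R := by omega
  refine ⟨R, 0, fun N _ i hiR hiRN t ht => ?_⟩
  have hN : 0 < N := by omega
  have hic : i.val + 1 < N := by omega
  set s : ℝ≥0 := t.toNNReal with hs
  have hst : (s : ℝ) ≤ τ := by rw [hs, Real.coe_toNNReal _ ht.1]; exact ht.2
  have hMi := hM N i
  set i1 : Fin N := ⟨i.val + 1, hic⟩ with hi1
  have hi1v : i1.val = i.val + 1 := rfl
  -- the pair correlations and their far bound
  set K : Fin N → ℝ := fun k => ∫ z, P.bondCurrent N i z *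
    (∫ y, P.bondCurrent N k y ∂(P.transitionKernel N T T s z)) ∂(P.gibbsMeasure N T) with hK
  have hfar : ∀ k : Fin N, R < ((k : ℤ) - (i : ℤ)).natAbs → |K k| ≤ ψ ((k : ℤ) - (i : ℤ)).natAbs := by
    intro k hkR
    obtain ⟨n, hn⟩ : ∃ n : ℕ, n = ((k : ℤ) - (i : ℤ)).natAbs := ⟨_, rfl⟩
    rw [← hn]
    by_cases hk : k.val + 1 < N
    · -- a genuine far bond: the two single flips are at distances `{n - 1, n} ≥ D₀`
      have hki : k ≠ i := by
        intro h; rw [h] at hkR; simp at hkR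
      rcases lt_or_gt_of_ne hki with hlt | hgt
      · -- `k < i`: flip at `i` has `D = n - 1`, flip at `i + 1` has `D = n`
        have hlt' : k.val < i.val := hlt
        have h₁ := hfl N i k hk (n - 1) (by omega) (by omega) (by omega) (by omega) (by omega) s hst
        have h₂ := hfl N i1 k hk n (by omega) (by omega) (by omega) (by omega) (by omega) s hst
        have hb := abs_pairCorr_le_of_singleFlips hω hl hβ hγ hT hN i k hic hMi s (ha0 _) (ha0 _) h₁ h₂
        rw [hψ, add_comm (a n)]
        exact hb
      · -- `k > i`: flip at `i` has `D = n`, flip at `i + 1` has `D = n - 1`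
        have hgt' : i.val < k.val := hgt
        have h₁ := hfl N i k hk n (by omega) (by omega) (by omega) (by omega) (by omega) s hst
        have h₂ := hfl N i1 k hk (n - 1) (by omega) (by omega) (by omega) (by omega) (by omega) s hst
        have hb := abs_pairCorr_le_of_singleFlips hω hl hβ hγ hT hN i k hic hMi s (ha0 _) (ha0 _) h₁ h₂
        rw [hψ]
        exact hb
    · -- the phantom last bond: `j_k ≡ 0`
      have hlast : k.val + 1 = N := by omega
      have h0 : ∀ y, P.bondCurrent N k y = 0 := fun y => P.bondCurrent_eq_zero_of_last N k hlast y
      simp only [hK, h0, integral_zero, mul_zero, abs_zero]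
      exact hψ0 n
  -- the summand and its two one-sided majorants
  set f : Fin N → ℝ := fun k => if i.val ≤ k.val + R ∧ k.val ≤ i.val + R then (0 : ℝ) else |K k| with hf
  set gp : Fin N → ℝ := fun k => if i.val < k.val ∧ R < k.val - i.val then ψ (k.val - i.val) else 0 with hgp
  set gm : Fin N → ℝ := fun k => if k.val < i.val ∧ R < i.val - k.val then ψ (i.val - k.val) else 0 with hgm
  have hgp0 : ∀ k, 0 ≤ gp k := fun k => by simp only [hgp]; split_ifs <;> [exact hψ0 _; exact le_rfl]
  have hgm0 : ∀ k, 0 ≤ gm k := fun k => by simp only [hgm]; split_ifs <;> [exact hψ0 _; exact le_rfl]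
  have hpt : ∀ k, f k ≤ gp k + gm k := by
    intro k
    by_cases hw : i.val ≤ k.val + R ∧ k.val ≤ i.val + R
    · have : f k = 0 := by simp only [hf, if_pos hw]
      rw [this]; exact add_nonneg (hgp0 k) (hgm0 k)
    · have hfk : f k = |K k| := by simp only [hf, if_neg hw]
      rw [hfk]
      rcases not_and_or.1 hw with h1 | h2
      · -- `k + R < i`
        have h1' : k.val + R < i.val := by omega
        have hcond : k.val < i.val ∧ R < i.val - k.val := ⟨by omega, by omega⟩
        have hgmk : gm k = ψ (i.val - k.val) := by simp only [hgm, if_pos hcond]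
        have hnat : ((k : ℤ) - (i : ℤ)).natAbs = i.val - k.val := by omega
        have hb := hfar k (by omega)
        rw [hnat] at hb
        rw [hgmk]
        linarith [hgp0 k]
      · -- `i + R < k`
        have h2' : i.val + R < k.val := by omega
        have hcond : i.val < k.val ∧ R < k.val - i.val := ⟨by omega, by omega⟩
        have hgpk : gp k = ψ (k.val - i.val) := by simp only [hgp, if_pos hcond]
        have hnat : ((k : ℤ) - (i : ℤ)).natAbs = k.val - i.val := by omega
        have hb := hfar k (by omega)
        rw [hnat] at hb
        rw [hgpk]
        linarith [hgm0 k]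
  -- the one-sided sums are far blocks of `Σ ψ`
  have hsum_p : ∑ k, gp k < ε / 2 := by
    set S := Finset.univ.filter fun k : Fin N => i.val < k.val ∧ R < k.val - i.val with hS
    have e1 : ∑ k, gp k = ∑ k ∈ S, ψ (k.val - i.val) := by rw [hS, Finset.sum_filter]
    set φ : Fin N → ℕ := fun k => k.val - i.val with hφ
    have hinj : ∀ k ∈ S, ∀ k' ∈ S, φ k = φ k' → k = k' := by
      intro k hk k' hk' h
      simp only [hS, Finset.mem_filter, Finset.mem_univ, true_and] at hk hk'
      simp only [hφ] at h
      exact Fin.ext (by omega)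
    have e2 : ∑ k ∈ S, ψ (k.val - i.val) = ∑ m ∈ S.image φ, ψ m := (Finset.sum_image (f := ψ) hinj).symm
    have hdisj : Disjoint (S.image φ) s₀ := by
      refine Finset.disjoint_left.2 fun m hm hms => ?_
      simp only [Finset.mem_image] at hm
      obtain ⟨k, hk, rfl⟩ := hm
      simp only [hS, Finset.mem_filter, Finset.mem_univ, true_and] at hk
      have := hRs _ hms
      simp only [hφ] at this
      omega
    have hv := hs₀ (S.image φ) hdisj
    rw [Real.norm_eq_abs, abs_of_nonneg (Finset.sum_nonneg fun m _ => hψ0 m)] at hv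
    rw [e1, e2]
    exact hv
  have hsum_m : ∑ k, gm k < ε / 2 := by
    set S := Finset.univ.filter fun k : Fin N => k.val < i.val ∧ R < i.val - k.val with hS
    have e1 : ∑ k, gm k = ∑ k ∈ S, ψ (i.val - k.val) := by rw [hS, Finset.sum_filter]
    set φ : Fin N → ℕ := fun k => i.val - k.val with hφ
    have hinj : ∀ k ∈ S, ∀ k' ∈ S, φ k = φ k' → k = k' := by
      intro k hk k' hk' h
      simp only [hS, Finset.mem_filter, Finset.mem_univ, true_and] at hk hk'
      simp only [hφ] at h
      exact Fin.ext (by omega)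
    have e2 : ∑ k ∈ S, ψ (i.val - k.val) = ∑ m ∈ S.image φ, ψ m := (Finset.sum_image (f := ψ) hinj).symm
    have hdisj : Disjoint (S.image φ) s₀ := by
      refine Finset.disjoint_left.2 fun m hm hms => ?_
      simp only [Finset.mem_image] at hm
      obtain ⟨k, hk, rfl⟩ := hm
      simp only [hS, Finset.mem_filter, Finset.mem_univ, true_and] at hk
      have := hRs _ hms
      simp only [hφ] at this
      omega
    have hv := hs₀ (S.image φ) hdisj
    rw [Real.norm_eq_abs, abs_of_nonneg (Finset.sum_nonneg fun m _ => hψ0 m)] at hv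
    rw [e1, e2]
    exact hv
  calc ∑ k, f k ≤ ∑ k, (gp k + gm k) := Finset.sum_le_sum fun k _ => hpt k
    _ = ∑ k, gp k + ∑ k, gm k := Finset.sum_add_distrib
    _ ≤ ε := by linarith

/-- **Leaf (C) of S4 — `stub_anchoredCorrelationTails` (registered, VERBATIM): `N`-uniform anchored correlation tails
of the open chain at fixed time**, `Σ_{|k - c_N| > R} |⟨j_{c_N}(0) j_k(t)⟩_{N,T}| ≤ ε` for `N ≥ N₀`, `t ∈ [0, τ]` —
from `uniformAnchoredCorrelationTails` via `SeriesLawAtEveryLaplaceFrequency.stub_anchoredCorrelationTailsOfUniform`. [folklore] -/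
theorem stub_anchoredCorrelationTails :
    ∀ ω₂ lam β γ : ℝ, 0 < ω₂ → 0 < lam → 0 < β → 0 < γ → ∀ T : ℝ, 0 < T →
      ∀ τ : ℝ, 0 < τ → ∀ ε : ℝ, 0 < ε → ∃ R : ℕ, ∃ N₀ : ℕ, ∀ N : ℕ, N₀ ≤ N → ∀ hN : 2 ≤ N,
        ∀ t ∈ Set.Icc (0 : ℝ) τ,
          (∑ k : Fin N, if (N - 1) / 2 ≤ k.val + R ∧ k.val ≤ (N - 1) / 2 + R then (0 : ℝ) else
            |∫ z, (Literature.MathematicalPhysics.KineticTheory.HeatConduction.pinnedChain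
                      ω₂ lam β γ).bondCurrent N ⟨(N - 1) / 2, by omega⟩ z *
                (∫ y, (Literature.MathematicalPhysics.KineticTheory.HeatConduction.pinnedChain
                      ω₂ lam β γ).bondCurrent N k y
                  ∂((Literature.MathematicalPhysics.KineticTheory.HeatConduction.pinnedChain
                      ω₂ lam β γ).transitionKernel N T T t.toNNReal z))
              ∂((Literature.MathematicalPhysics.KineticTheory.HeatConduction.pinnedChain
                      ω₂ lam β γ).gibbsMeasure N T)|) ≤ ε :=
  SeriesLawAtEveryLaplaceFrequency.stub_anchoredCorrelationTailsOfUniform uniformAnchoredCorrelationTails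

end Tails

end Summit.AtomisticToContinuum.FouriersLaw.Theorems.AbelThermodynamicLimit.LoomisCompactHorizonWitness

end
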